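import Mathlib
import Summits.KontsevichZagierPeriods.Zeta5Search.Families.SeatingGapGauge
import HarnessLib

/-!
# ζ(5) search — Families: `gapCT τ n` is invariant under the dihedral relabellings of the points (reflection + rotation)

HONEST FRAMING: systematic search; no irrationality claim unless certified.  Cell `pub-zeta5`, seat P2 g10 (Families
layer), 2026-08-23.  Identities between integers (coefficients of integer polynomials); nothing about any zeta value; no
record moves; no conjecture node is used.

`Families/SeatingGapGauge` proved that cert-2 g11's diagonal gap constant terms `gapCT τ n` (`Families/SeatingGapGrowth`; the
census leading coefficients of all `N = 8` classes) are invariant under label ROTATIONS `τ ↦ τ + c` (gauge independence).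
Here the label REFLECTION: `τ ↦ (ℓ+1) − τ` fixes the point at infinity `ℓ + 2` and reverses the finite points, hence reverses
the gaps (`Fin.rev`), and a coefficient at the constant exponent vector `n·𝟙` is unchanged by a permutation of the variables:
* `SeatingGap.gapCT_reflect : gapCT (fun i => (ℓ+1) − τ i) n = gapCT τ n` (every seating);
* **`SeatingGap.gapCT_const_sub : gapCT (fun i => c − τ i) n = gapCT τ n`** (bijective `τ`, every `c`) — with
  `gapCT_add_const` these are the two LABEL generators of Brown's dihedral equivalence of seating plans
  ([Brown2016, Def. 3.1]; tree `ConvergentClasses.act`); the two POSITION generators (`τ ∘ (· + r)`, `τ ∘ (c − ·)`) only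
  re-index the edge product and are left to the reader of `gapPoly_eq_prod_finEdges`.
Standard axioms only.
-/

namespace Summit.KontsevichZagierPeriods.Zeta5Search.Families.Cellular

namespace SeatingGap

open MvPolynomial Finset GapRegime

variable {ℓ : ℕ} (τ : Fin (ℓ + 3) → Fin (ℓ + 3))

/-- Reversing the gaps reverses a span: `rename Fin.rev (spanPoly ℓ i j) = spanPoly ℓ (ℓ+1−j) (ℓ+1−i)` (`i ≤ j ≤ ℓ+1`). -/
theorem rename_rev_spanPoly (i j : ℕ) (hij : i ≤ j) (hj : j ≤ ℓ + 1) :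
    rename Fin.rev (GapRegime.spanPoly ℓ i j) = GapRegime.spanPoly ℓ (ℓ + 1 - j) (ℓ + 1 - i) := by
  unfold GapRegime.spanPoly
  rw [map_sum]
  simp only [apply_ite (rename Fin.rev), rename_X, map_zero]
  rw [← Fintype.sum_equiv Fin.revPerm (fun s => if i ≤ (Fin.rev s).val ∧ (Fin.rev s).val < j then
      (X (Fin.rev (Fin.rev s)) : MvPolynomial (Fin (ℓ + 1)) ℤ) else 0) _ (fun t => rfl)]
  refine Finset.sum_congr rfl fun s _ => ?_
  rw [Fin.rev_rev]
  have hs := s.isLt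
  have hv : (Fin.rev s).val = ℓ - s.val := by rw [Fin.val_rev]; omega
  by_cases h : i ≤ (Fin.rev s).val ∧ (Fin.rev s).val < j
  · rw [if_pos h, if_pos (by rw [hv] at h; omega)]
  · rw [if_neg h, if_neg (by rw [hv] at h; omega)]

/-- The reflection of the points fixing infinity: `x ↦ (ℓ+1) − x` on `Fin (ℓ+3)` (so `ℓ+2 ↦ ℓ+2`). -/
theorem val_reflect (x : Fin (ℓ + 3)) :
    (((⟨ℓ + 1, by omega⟩ : Fin (ℓ + 3)) - x).val = if x.val = ℓ + 2 then ℓ + 2 else ℓ + 1 - x.val) := by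
  rw [Fin.sub_def]
  simp only
  have hx := x.isLt
  split_ifs with h
  · rw [h, show ℓ + 3 - (ℓ + 2) + (ℓ + 1) = ℓ + 2 by omega, Nat.mod_eq_of_lt (by omega)]
  · rw [show ℓ + 3 - x.val + (ℓ + 1) = (ℓ + 1 - x.val) + (ℓ + 3) by omega, Nat.add_mod_right,
      Nat.mod_eq_of_lt (by omega)]

/-- **Label reflection fixing infinity**: `gapCT ((ℓ+1) − τ) n = gapCT τ n` for every seating. -/
theorem gapCT_reflect (n : ℕ) :
    gapCT (fun i => (⟨ℓ + 1, by omega⟩ : Fin (ℓ + 3)) - τ i) n = gapCT τ n := by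
  classical
  set ρ : Fin (ℓ + 3) → Fin (ℓ + 3) := fun i => (⟨ℓ + 1, by omega⟩ : Fin (ℓ + 3)) - τ i with hρ
  -- same finite edges
  have hfin : finEdges ρ = finEdges τ := by
    ext e
    simp only [finEdges, mem_filter, mem_univ, true_and, hρ, val_reflect]
    have h1 := (τ e).isLt; have h2 := (τ (e + 1)).isLt
    constructor
    · rintro ⟨ha, hb⟩
      constructor
      · intro h; rw [if_pos h] at ha; exact ha rfl
      · intro h; rw [if_pos h] at hb; exact hb rfl
    · rintro ⟨ha, hb⟩
      rw [if_neg ha, if_neg hb]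
      constructor <;> omega
  -- reflected endpoint pairs
  have hpair : ∀ e ∈ finEdges τ, GapRegime.spanPoly ℓ (ePair ρ e).1 (ePair ρ e).2 =
      rename Fin.rev (GapRegime.spanPoly ℓ (ePair τ e).1 (ePair τ e).2) := by
    intro e he
    simp only [finEdges, mem_filter, mem_univ, true_and] at he
    have h1 := (τ e).isLt; have h2 := (τ (e + 1)).isLt
    rw [rename_rev_spanPoly _ _ (by simp [ePair]) (by simp only [ePair]; omega)]
    simp only [ePair, hρ, val_reflect, if_neg he.1, if_neg he.2]
    congr 1 <;> omega
  -- the gap polynomial is renamed, the diagonal coefficient unchanged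
  have hpoly : gapPoly ρ n = rename Fin.rev (gapPoly τ n) := by
    rw [gapPoly_eq_prod_finEdges, gapPoly_eq_prod_finEdges, hfin, map_prod]
    refine Finset.prod_congr rfl fun e he => ?_
    rw [map_pow, hpair e he]
  have hones : Finsupp.mapDomain Fin.rev (n • ones (ℓ + 1)) = n • ones (ℓ + 1) := by
    ext w
    rw [show w = Fin.rev (Fin.rev w) from (Fin.rev_rev w).symm, Finsupp.mapDomain_apply Fin.rev_injective, Fin.rev_rev]
    simp [ones]
  unfold gapCT
  rw [hpoly, ← hones, coeff_rename_mapDomain _ Fin.rev_injective, hones]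

/-- **Label reflections**: `gapCT (c − τ) n = gapCT τ n` for a bijective seating and every `c` (= reflection fixing infinity
followed by the rotation `+ (c − (ℓ+1))`, `gapCT_add_const`). -/
theorem gapCT_const_sub (hτ : Function.Bijective τ) (c : Fin (ℓ + 3)) (n : ℕ) :
    gapCT (fun i => c - τ i) n = gapCT τ n := by
  have hρ : Function.Bijective fun i => (⟨ℓ + 1, by omega⟩ : Fin (ℓ + 3)) - τ i :=
    (Equiv.subLeft (⟨ℓ + 1, by omega⟩ : Fin (ℓ + 3))).bijective.comp hτ
  have e : (fun i => c - τ i) = fun i => ((⟨ℓ + 1, by omega⟩ : Fin (ℓ + 3)) - τ i) + (c - ⟨ℓ + 1, by omega⟩) := by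
    funext i; abel
  rw [e, gapCT_add_const _ hρ, gapCT_reflect]

end SeatingGap

end Summit.KontsevichZagierPeriods.Zeta5Search.Families.Cellular
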